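import Summits.QuantumFields.YangMills.Theorems.BalabanUVNodesK0RecordFormatNamesLemmas8
import Literature.Analysis.Complex.LocallyUniformLimitSCV

/-!
# NODE O port PT-A — ROWS (LOC) ∕ (GI) ∕ (a) ∕ (b) FOR INFINITE SUMS OF INTEGER FORMULAS: the shape in which both residue objects are built
# (`Ψ_LZ` = the regrouped random-walk series of [16] (63) ∕ [5] (23); `Ψ_FE` = the polymer series of [II] (2.13) ∕ Lemma 3 ∕ (2.39)–(2.41)) —
# window-locality and `SL(2,ℂ)`-invariance pass to `∑'` termwise; (b) by the comparison of the series with its majorant; (a) by the tree's several-variable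
# WEIERSTRASS M-TEST (`Literature.Analysis.Complex.SCV.analyticOnNhd_tsum_of_summable_norm`: normally convergent series of holomorphic maps on an open set are analytic)

Cell `ym-nodeO-ideate`, porter seat `ymgap-nodeO-port-PTA-1` (gen 3); `--supports stmt-QuantumFields-27930` (helper).  [I] = [Balaban1987RG1], [II] = [Balaban1988RG2Cluster],
[16] = [Balaban1985UVStability3D].  Vocabulary: DEF-1 edition 13 (`…K0RecordFormatNamesIntLocal`: `IntFormula`, `IsLocal`, `IsGaugeInv`, `IntLocalFormula`, `piece`, `AnalyticOnUc`,
`Bound118OnUc`) and lemma file 8 (`piece_eq`, `analyticOnUc_iff`, `bound118OnUc_iff`).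

WHY.  Print's localized pieces are SERIES: [I] p.261 L22–24 «terms of the expansion (63) in [16]», [II] (2.13) p.14 «Σ over polymers», bounded through [5] (23) ∕ [II] (2.41) by
summable majorants `Σ_ω K q^{|ω|} e^{−κ d}` — so every (R4) porter proves (a)(b) for a `∑'` of FINITE formulas (each analytic by `…PortS1LocalFormula` §6
`analyticAt_cpair_of_finiteFormula`).  This file is that passage, once, in the residue's currency:
* §1 (LOC)∕(GI) for `fun X̂ f => ∑' i, T i X̂ f` UNCONDITIONALLY (`tsum` of termwise-equal families agree — no convergence needed), for finite partial sums, and for a named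
  candidate total `Ψ` with `HasSum` (uniqueness of limits).
* §2 (b): termwise bounds `‖(T i).piece … X φ‖ ≤ u i n X` on `recordUc` with `HasSum (u · n X) (U n X)`, `U n X ≤ E₀ e^{−κ d(X)}` ⟹ `Ψ.Bound118OnUc … E₀ κ` (`tsum_of_norm_bounded`).
* §3 (a): an OPEN set `O n X ⊇ {φ | encodeCfg φ ∈ recordUc … X}` on which every term's piece is `ℂ`-differentiable with a summable uniform majorant ⟹ `Ψ.AnalyticOnUc` (Weierstrass
  M-test, several complex variables, finite-dimensional domain `Sect2.CPair`).
* §4 the two rows bundled for an `IntLocalFormula` total.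

HONEST FRAMING.  Plumbing (classical analysis by name); NO piece of Bałaban's is constructed, NO bound of the series ((23), (2.41)) is asserted; the residue is NOT proved; 27930 OPEN;
K0⁷ NOT closed; NODE O 0∕1; COUNT 8∕28 · K 1∕4 UNMOVED; finite `𝕋⁴_{L^K}` at fixed ε — NOT continuum ∕ OS ∕ Clay; **the Yang–Mills mass gap is NOT proved by any of this.**
No `sorry`, no `def`, no `instance`; standard axioms.
-/

noncomputable section

open scoped BigOperators Matrix.Norms.L2Operator Topology

namespace Summit.QuantumFields.YangMills.Theorems.BalabanUVNodesPortS1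

open Summit.QuantumFields.YangMills.Theorems.K0RecordFormatNames
open Literature.MathematicalPhysics.QuantumFieldTheory.Balaban1983to89
open Literature.MathematicalPhysics.QuantumFieldTheory.Balaban1983to89.Node00
open Literature.MathematicalPhysics.QuantumFieldTheory.Balaban1983to89.T4Continuum (T4Family)
open _root_.Filter

variable {ι : Type*}

/-! ## §1  (LOC) and (GI) for series, partial sums, and named totals -/

/-- **Window-locality of a series, unconditionally**: if every term is window-local at side `s`, so is `X̂, f ↦ ∑' i, T i X̂ f` (termwise-equal families have equal `tsum`,
convergent or not). [cite: Balaban1987RG1, (1.7) p.261; Balaban1988RG2Cluster, (2.13) p.14] -/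
theorem isLocal_tsum (s : ℕ) (T : ι → IntFormula) (hT : ∀ i, (T i).IsLocal s) :
    IntFormula.IsLocal s (fun Xh f => ∑' i, T i Xh f) := by
  intro Xh f f' h
  exact tsum_congr fun i => hT i Xh f f' h

/-- **`SL(2,ℂ)`-invariance of a series, unconditionally.** [cite: Balaban1987RG1, (1.19) p.263, (1.10) p.262; Balaban1988RG2Cluster, (2.13) p.14] -/
theorem isGaugeInv_tsum (T : ι → IntFormula) (hT : ∀ i, (T i).IsGaugeInv) :
    IntFormula.IsGaugeInv (fun Xh f => ∑' i, T i Xh f) := by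
  intro Xh û hû f
  exact tsum_congr fun i => hT i Xh û hû f

/-- Window-locality of a finite partial sum. [cite: Balaban1987RG1, (1.7) p.261 (bookkeeping)] -/
theorem isLocal_finsetSum (s : ℕ) (T : ι → IntFormula) (hT : ∀ i, (T i).IsLocal s) (S : Finset ι) :
    IntFormula.IsLocal s (fun Xh f => ∑ i ∈ S, T i Xh f) := by
  intro Xh f f' h
  exact Finset.sum_congr rfl fun i _ => hT i Xh f f' h

/-- `SL(2,ℂ)`-invariance of a finite partial sum. [cite: Balaban1987RG1, (1.19) p.263 (bookkeeping)] -/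
theorem isGaugeInv_finsetSum (T : ι → IntFormula) (hT : ∀ i, (T i).IsGaugeInv) (S : Finset ι) :
    IntFormula.IsGaugeInv (fun Xh f => ∑ i ∈ S, T i Xh f) := by
  intro Xh û hû f
  exact Finset.sum_congr rfl fun i _ => hT i Xh û hû f

/-- Window-locality of a NAMED total `Ψ` of a convergent series of window-local terms (uniqueness of the sum). [cite: Balaban1987RG1, (1.7) p.261 (bookkeeping)] -/
theorem isLocal_of_hasSum (s : ℕ) (T : ι → IntFormula) (Ψ : IntFormula) (hsum : ∀ Xh f, HasSum (fun i => T i Xh f) (Ψ Xh f))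
    (hT : ∀ i, (T i).IsLocal s) : Ψ.IsLocal s := by
  intro Xh f f' h
  have hfun : (fun i => T i Xh f) = fun i => T i Xh f' := funext fun i => hT i Xh f f' h
  exact (hsum Xh f).unique (hfun ▸ hsum Xh f')

/-- `SL(2,ℂ)`-invariance of a NAMED total of a convergent series of invariant terms. [cite: Balaban1987RG1, (1.19) p.263 (bookkeeping)] -/
theorem isGaugeInv_of_hasSum (T : ι → IntFormula) (Ψ : IntFormula) (hsum : ∀ Xh f, HasSum (fun i => T i Xh f) (Ψ Xh f))
    (hT : ∀ i, (T i).IsGaugeInv) : Ψ.IsGaugeInv := by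
  intro Xh û hû f
  have hfun : (fun i => T i Xh (intGaugeAct û f)) = fun i => T i Xh f := funext fun i => hT i Xh û hû f
  exact (hsum Xh _).unique (hfun ▸ hsum Xh f)

/-! ## §2  ROW (b) for a series: the (1.18) bound from a summable termwise majorant -/

variable (F : T4Family)

/-- The piece of a total is the series of the pieces of the terms (pointwise `HasSum`). [cite: Balaban1987RG1, (1.7) p.261 (bookkeeping)] -/
theorem hasSum_piece (T : ι → IntFormula) (Ψ : IntFormula) (hsum : ∀ Xh f, HasSum (fun i => T i Xh f) (Ψ Xh f))
    (Mc k K : ℕ) (X : (recordDomSys F Mc k K).Dom) (φ : Sect2.CPair (F.P K) (MatA 2)) :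
    HasSum (fun i => (T i).piece F Mc k K X φ) (Ψ.piece F Mc k K X φ) :=
  hsum _ _

/-- **ROW (b) FOR A SERIES.**  Termwise bounds on the record spaces, `‖(T i).piece … X φ‖ ≤ u i n X` for `encodeCfg φ ∈ recordUc … X`, with a majorant series
`HasSum (u · n X) (U n X)` and `U n X ≤ E₀ e^{−κ d_{k+1}(X)}` give the (1.18) row for the total: `Ψ.Bound118OnUc F Mc k α₀ α₁ E₀ κ`.  (The shape of [5] (23) summed over walks,
[16] p.262 «Summing the expressions with the same localization X», and of [II] (2.41).) [cite: Balaban1987RG1, (1.18) p.263; Balaban1985UVStability3D, (23)–(25) p.262; Balaban1988RG2Cluster, (2.41) p.21] -/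
theorem bound118OnUc_of_hasSum (Mc k : ℕ) (α₀ α₁ E₀ κ : ℝ) (T : ι → IntFormula) (Ψ : IntFormula)
    (hsum : ∀ Xh f, HasSum (fun i => T i Xh f) (Ψ Xh f))
    (u : ι → (n : ℕ) → (recordDomSys F Mc k (recordK₀ F Mc k + n)).Dom → ℝ)
    (U : (n : ℕ) → (recordDomSys F Mc k (recordK₀ F Mc k + n)).Dom → ℝ)
    (hb : ∀ i n (X : (recordDomSys F Mc k (recordK₀ F Mc k + n)).Dom) (φ : Sect2.CPair (F.P (recordK₀ F Mc k + n)) (MatA 2)),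
      encodeCfg F (recordK₀ F Mc k + n) φ ∈ recordUc F Mc k α₀ α₁ (recordK₀ F Mc k + n) X →
        ‖(T i).piece F Mc k (recordK₀ F Mc k + n) X φ‖ ≤ u i n X)
    (hu : ∀ n X, HasSum (fun i => u i n X) (U n X))
    (hU : ∀ n X, U n X ≤ E₀ * Real.exp (-κ * (recordDomSys F Mc k (recordK₀ F Mc k + n)).dj X)) :
    Ψ.Bound118OnUc F Mc k α₀ α₁ E₀ κ := by
  rw [IntFormula.bound118OnUc_iff]
  intro n X φ hφ
  rw [← (hasSum_piece F T Ψ hsum Mc k _ X φ).tsum_eq]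
  exact (tsum_of_norm_bounded (hu n X) fun i => hb i n X φ hφ).trans (hU n X)

/-! ## §3  ROW (a) for a series: Weierstrass M-test in several complex variables -/

/-- **ROW (a) FOR A SERIES.**  For every volume `K₀ + n` and domain `X`, an OPEN set `O n X` of pairs containing the record space `{φ | encodeCfg φ ∈ recordUc … X}` on which every
term's piece is `ℂ`-differentiable and bounded by a summable uniform majorant `u i n X` — then the total's piece is analytic at every pair of the record space:
`Ψ.AnalyticOnUc F Mc k α₀ α₁` (Weierstrass: normally convergent series of holomorphic maps of finitely many complex variables are holomorphic, the tree's
`Literature.Analysis.Complex.SCV.analyticOnNhd_tsum_of_summable_norm`). [cite: Balaban1987RG1, p.263 («defined and analytic on the space U^c_j(X, α₀, α₁)»), (1.18) p.263; Balaban1988RG2Cluster, (2.41) p.21] -/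
theorem analyticOnUc_of_summable (Mc k : ℕ) (α₀ α₁ : ℝ) (T : ι → IntFormula) (Ψ : IntFormula)
    (hsum : ∀ Xh f, HasSum (fun i => T i Xh f) (Ψ Xh f))
    (O : (n : ℕ) → (recordDomSys F Mc k (recordK₀ F Mc k + n)).Dom → Set (Sect2.CPair (F.P (recordK₀ F Mc k + n)) (MatA 2)))
    (hO : ∀ n X, IsOpen (O n X))
    (hUcO : ∀ n (X : (recordDomSys F Mc k (recordK₀ F Mc k + n)).Dom) (φ : Sect2.CPair (F.P (recordK₀ F Mc k + n)) (MatA 2)),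
      encodeCfg F (recordK₀ F Mc k + n) φ ∈ recordUc F Mc k α₀ α₁ (recordK₀ F Mc k + n) X → φ ∈ O n X)
    (hd : ∀ i n X, DifferentiableOn ℂ (fun φ => (T i).piece F Mc k (recordK₀ F Mc k + n) X φ) (O n X))
    (u : ι → (n : ℕ) → (recordDomSys F Mc k (recordK₀ F Mc k + n)).Dom → ℝ)
    (hu : ∀ n X, Summable (fun i => u i n X))
    (hb : ∀ i n X, ∀ φ ∈ O n X, ‖(T i).piece F Mc k (recordK₀ F Mc k + n) X φ‖ ≤ u i n X) :
    Ψ.AnalyticOnUc F Mc k α₀ α₁ := by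
  rw [IntFormula.analyticOnUc_iff]
  intro n X φ hφ
  have hA := Literature.Analysis.Complex.SCV.analyticOnNhd_tsum_of_summable_norm (hO n X) (fun i => hd i n X) (hu n X)
    (fun i ψ hψ => hb i n X ψ hψ)
  have hfun : (fun ψ => Ψ.piece F Mc k (recordK₀ F Mc k + n) X ψ) =
      fun ψ => ∑' i, (T i).piece F Mc k (recordK₀ F Mc k + n) X ψ :=
    funext fun ψ => ((hasSum_piece F T Ψ hsum Mc k _ X ψ).tsum_eq).symm
  rw [hfun]
  exact hA φ (hUcO n X φ hφ)

/-- **ROW (a) FOR A FINITE FORMULA-SUM** (no majorant needed): finitely many terms, each with piece `ℂ`-differentiable on an open `O n X ⊇` the record space.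
[cite: Balaban1987RG1, p.263 (bookkeeping)] -/
theorem analyticOnUc_finsetSum (Mc k : ℕ) (α₀ α₁ : ℝ) (T : ι → IntFormula) (S : Finset ι)
    (O : (n : ℕ) → (recordDomSys F Mc k (recordK₀ F Mc k + n)).Dom → Set (Sect2.CPair (F.P (recordK₀ F Mc k + n)) (MatA 2)))
    (hO : ∀ n X, IsOpen (O n X))
    (hUcO : ∀ n (X : (recordDomSys F Mc k (recordK₀ F Mc k + n)).Dom) (φ : Sect2.CPair (F.P (recordK₀ F Mc k + n)) (MatA 2)),
      encodeCfg F (recordK₀ F Mc k + n) φ ∈ recordUc F Mc k α₀ α₁ (recordK₀ F Mc k + n) X → φ ∈ O n X)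
    (hd : ∀ i ∈ S, ∀ n X, DifferentiableOn ℂ (fun φ => (T i).piece F Mc k (recordK₀ F Mc k + n) X φ) (O n X)) :
    IntFormula.AnalyticOnUc F (fun Xh f => ∑ i ∈ S, T i Xh f) Mc k α₀ α₁ := by
  rw [IntFormula.analyticOnUc_iff]
  intro n X φ hφ
  have hdS : DifferentiableOn ℂ (fun ψ => ∑ i ∈ S, (T i).piece F Mc k (recordK₀ F Mc k + n) X ψ) (O n X) :=
    DifferentiableOn.fun_sum fun i hi => hd i hi n X
  have hA := Literature.Analysis.Complex.SCV.analyticOnNhd_of_differentiableOn hdS (hO n X)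
  exact hA φ (hUcO n X φ hφ)

/-! ## §4  Bundled: the two rows for an `IntLocalFormula` total -/

/-- **(a) ∧ (b) FOR A SERIES OBJECT**: an `IntLocalFormula` total `Ψ` of a family of integer formulas `T i` (pointwise `HasSum`), open neighbourhoods `O n X` of the record spaces on
which the terms' pieces are holomorphic with a summable uniform majorant `u`, whose sums are `≤ E₀ e^{−κ d(X)}` — gives `Ψ.Ψ.AnalyticOnUc ∧ Ψ.Ψ.Bound118OnUc … E₀ κ`, i.e. the residue
`Ψ.ResidueAt …` up to its (f′) conjunct. [cite: Balaban1987RG1, (1.18) p.263, p.263 («analytic on the space U^c_j»); Balaban1988RG2Cluster, (2.41) p.21; Balaban1985UVStability3D, (23) p.262] -/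
theorem analytic_and_bound_of_series (Mc k : ℕ) (α₀ α₁ E₀ κ : ℝ) (T : ι → IntFormula) (Ψ : IntLocalFormula (F.L ^ (k + 1) * Mc))
    (hsum : ∀ Xh f, HasSum (fun i => T i Xh f) (Ψ.Ψ Xh f))
    (O : (n : ℕ) → (recordDomSys F Mc k (recordK₀ F Mc k + n)).Dom → Set (Sect2.CPair (F.P (recordK₀ F Mc k + n)) (MatA 2)))
    (hO : ∀ n X, IsOpen (O n X))
    (hUcO : ∀ n (X : (recordDomSys F Mc k (recordK₀ F Mc k + n)).Dom) (φ : Sect2.CPair (F.P (recordK₀ F Mc k + n)) (MatA 2)),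
      encodeCfg F (recordK₀ F Mc k + n) φ ∈ recordUc F Mc k α₀ α₁ (recordK₀ F Mc k + n) X → φ ∈ O n X)
    (hd : ∀ i n X, DifferentiableOn ℂ (fun φ => (T i).piece F Mc k (recordK₀ F Mc k + n) X φ) (O n X))
    (u : ι → (n : ℕ) → (recordDomSys F Mc k (recordK₀ F Mc k + n)).Dom → ℝ)
    (U : (n : ℕ) → (recordDomSys F Mc k (recordK₀ F Mc k + n)).Dom → ℝ)
    (hu : ∀ n X, HasSum (fun i => u i n X) (U n X))
    (hb : ∀ i n X, ∀ φ ∈ O n X, ‖(T i).piece F Mc k (recordK₀ F Mc k + n) X φ‖ ≤ u i n X)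
    (hU : ∀ n X, U n X ≤ E₀ * Real.exp (-κ * (recordDomSys F Mc k (recordK₀ F Mc k + n)).dj X)) :
    Ψ.Ψ.AnalyticOnUc F Mc k α₀ α₁ ∧ Ψ.Ψ.Bound118OnUc F Mc k α₀ α₁ E₀ κ :=
  ⟨analyticOnUc_of_summable F Mc k α₀ α₁ T Ψ.Ψ hsum O hO hUcO hd u (fun n X => (hu n X).summable) hb,
    bound118OnUc_of_hasSum F Mc k α₀ α₁ E₀ κ T Ψ.Ψ hsum u U (fun i n X φ hφ => hb i n X φ (hUcO n X φ hφ)) hu hU⟩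

end Summit.QuantumFields.YangMills.Theorems.BalabanUVNodesPortS1

end
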